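import Mathlib
import HarnessLib
import Summits.NavierStokesRegularity.NavierStokesRegularity.Theorems.CompletionRelayChainDefs
import Summits.NavierStokesRegularity.NavierStokesRegularity.Theorems.CompletionRelayChainRelayFrontStepIgnitionClock

/-!
# `CompletionRelayChain` — crux `RelayFrontStep` (item stmt-NavierStokesRegularity-24850), LINE `window_v2`,
  registered stub `stub_ignition` (Phase II): SIGN / FLOOR lemmas along a pseudo-flow with the relay rows

Blueprint `IGNITION-BLUEPRINT-crc-p2.md` §1. The floor clauses of the checkpoint (`−1e-6 ≤ r₁/a`, `−1e-8 ≤ x₂/a`,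
`−1e-8 ≤ r₂/a`, …) are NOT read off the Phase-I Taylor models (whose remainders straddle zero) but follow from
one-sided LINEAR-IN-TIME lower bounds of the rows of `RelayRows`:
* `lower_linear_of_derivWithin_ge` — generic: `f′ ≥ −C` on `[a,b] ⊆ [0,τ]` ⇒ `f(t) ≥ f(a) − C (t − a)`;
  `abs_sub_le_linear_of_abs_derivWithin_le` — two-sided version;
* `x2_lower_linear` — old shell 2's carrier: `x₂′ ≥ −32 u₂² − 16κ√F₀₂`, hence `x₂(t) ≥ x₂(a) − (32U² + 16κG)(t − a)`
  whenever `|u₂| ≤ U`, `√F 0 2 ≤ G` on `[a,t]`;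
* `r1_lower_linear` — the next relay: `r₁′ ≥ −(Λ₁/32)·U₁·(X + U) − 4κG₁` whenever `0 ≤ u₁ ≤ U₁`, `x₂ ≥ −X`, `u₂ ≤ U`,
  `√F 2 1 ≤ G₁`; hence a linear lower bound for `r₁`;
* `r2_abs_linear` — old shell 2's relay moves by at most `(2 X₃ U + 16κG₂)(t − a)` when `|x₃|,|u₃| ≤ X₃`, `|u₂| ≤ U`;
* `r0_monotone_of` — the front relay is non-decreasing while `u₀ ≥ 0`, `x₁ − u₁ ≥ 32κG₀/u₀`-type positivity holds
  (stated with an explicit nonnegativity hypothesis on the row).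
(The `u₂` floor needs a variable-coefficient linear comparison — next file.) Generic in the defect constants `κ₁ κ₂`.

No definitions. HONEST FRAMING: elementary consequences of the MODEL-lattice rows (Tao 2016 §4 vocabulary); helper for the
crux, no stub credit; nothing here is a statement about the Navier–Stokes equations.
-/

noncomputable section

-- the summit-side namespace `Summit.NavierStokesRegularity.NavierStokesRegularity.…` (single-conjunct summit,
-- D-0017) repeats a component by design; the dupNamespace linter would flag every declaration.
set_option linter.dupNamespace false

open Set MeasureTheory intervalIntegral Literature.Analysis.FluidPDE Literature.Analysis.FluidPDE.TaoCascade

namespace Summit.NavierStokesRegularity.NavierStokesRegularity.Cruxes.RelayFrontStep.Window2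

/-! ### Generic linear-in-time bounds from one-sided derivative bounds -/

/-- `f′ ≥ −C` on `[a,b] ⊆ [0,τ]` (one-sided `derivWithin` on `Icc 0 τ`, `f` `C¹` there) ⇒ `f(t) ≥ f(a) − C (t − a)` on `[a,b]`.
[folklore] -/
theorem lower_linear_of_derivWithin_ge {f : ℝ → ℝ} {τ a b C : ℝ} (hτ : 0 < τ) (hf : ContDiffOn ℝ 1 f (Icc 0 τ))
    (ha : 0 ≤ a) (_hab : a ≤ b) (hb : b ≤ τ) (hle : ∀ s ∈ Icc a b, -C ≤ derivWithin f (Icc 0 τ) s) :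
    ∀ t ∈ Icc a b, f a - C * (t - a) ≤ f t := by
  intro t ht
  have h := integral_le_increment_of_le_derivWithin (g := fun _ => -C) hτ hf continuousOn_const ha ht.1 (ht.2.trans hb)
    (fun s hs => hle s ⟨hs.1, hs.2.trans ht.2⟩)
  rw [intervalIntegral.integral_const, smul_eq_mul] at h
  linarith

/-- `|f′| ≤ C` on `[a,b] ⊆ [0,τ]` ⇒ `|f(t) − f(a)| ≤ C (t − a)` on `[a,b]`. [folklore] -/
theorem abs_sub_le_linear_of_abs_derivWithin_le {f : ℝ → ℝ} {τ a b C : ℝ} (hτ : 0 < τ)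
    (hf : ContDiffOn ℝ 1 f (Icc 0 τ)) (ha : 0 ≤ a) (hab : a ≤ b) (hb : b ≤ τ)
    (hle : ∀ s ∈ Icc a b, |derivWithin f (Icc 0 τ) s| ≤ C) :
    ∀ t ∈ Icc a b, |f t - f a| ≤ C * (t - a) := by
  intro t ht
  have h1 := lower_linear_of_derivWithin_ge hτ hf ha hab hb (fun s hs => (abs_le.mp (hle s hs)).1) t ht
  have h2 := increment_le_integral_of_derivWithin_le (g := fun _ => C) hτ hf continuousOn_const ha ht.1 (ht.2.trans hb)
    (fun s hs => (abs_le.mp (hle s ⟨hs.1, hs.2.trans ht.2⟩)).2)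
  rw [intervalIntegral.integral_const, smul_eq_mul] at h2
  rw [abs_le]; constructor <;> linarith

/-! ### Row facts along a pseudo-flow with the relay rows (`ε₀ = 1`: `Λ₂ = 32`, `Λ₁ = 2^{5/2}`, `4^k` defect weights) -/

variable {τ κ₁ κ₂ : ℝ} {α : Fin 4 → Fin 4 → Fin 4 → ℤ × ℤ × ℤ → ℝ}
  {S₀ F₀ B₀ : Fin 4 → ℤ → ℝ} {S F : Fin 4 → ℤ → ℝ → ℝ}

/-- The clock at shell `2`: `(1+1)^{5·2/2} = 32`. -/
theorem clock_at_two : (1 + 1 : ℝ) ^ ((5 : ℝ) * ((2 : ℤ) : ℝ) / 2) = 32 := by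
  rw [show ((5 : ℝ) * ((2 : ℤ) : ℝ) / 2) = ((5 : ℕ) : ℝ) by push_cast; norm_num, Real.rpow_natCast]; norm_num

/-- The defect weight at shell `2`: `(1+1)^{2·2} = 16`. -/
theorem weight_at_two : (1 + 1 : ℝ) ^ ((2 : ℝ) * ((2 : ℤ) : ℝ)) = 16 := by
  rw [show ((2 : ℝ) * ((2 : ℤ) : ℝ)) = ((4 : ℕ) : ℝ) by push_cast; norm_num, Real.rpow_natCast]; norm_num

/-- The defect weight at shell `1`: `(1+1)^{2·1} = 4`. -/
theorem weight_at_one : (1 + 1 : ℝ) ^ ((2 : ℝ) * ((1 : ℤ) : ℝ)) = 4 := by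
  rw [show ((2 : ℝ) * ((1 : ℤ) : ℝ)) = ((2 : ℕ) : ℝ) by push_cast; norm_num, Real.rpow_natCast]; norm_num

/-- The lower clock is nonnegative. -/
theorem clock_nonneg (y : ℝ) : 0 ≤ (1 + 1 : ℝ) ^ y := (Real.rpow_pos_of_pos (by norm_num) _).le

/-- **Old shell 2's carrier, one-sided row bound**: `x₂′ ≥ −32·u₂² − 16κ₁·√F 0 2` along the flow
(`x₂′ = Λ₁u₁² − Λ₂u₂² ± defect`). [this file] -/
theorem x2_deriv_lower (h : PseudoFlowOn τ 1 α κ₁ κ₂ S₀ F₀ B₀ S F) (hrows : RelayRows α)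
    {s : ℝ} (hs : s ∈ Icc 0 τ) :
    -(32 * S 1 2 s ^ 2) - 16 * κ₁ * Real.sqrt (F 0 2 s) ≤ derivWithin (S 0 2) (Icc 0 τ) s := by
  have hm := h.motion 0 2 s hs
  rw [hrows.1 S 2 s, clock_at_two, weight_at_two] at hm
  have hlow := (abs_le.mp hm).1
  have hΛ1 : 0 ≤ (1 + 1 : ℝ) ^ ((5 : ℝ) * (((2 : ℤ) : ℝ) - 1) / 2) * (S 1 (2 - 1) s * S 1 (2 - 1) s) :=
    mul_nonneg (clock_nonneg _) (mul_self_nonneg _)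
  nlinarith [sq_nonneg (S 1 2 s)]

/-- **Linear lower bound for `x₂` on a sub-interval**: if `|u₂| ≤ U` and `√(F 0 2) ≤ G` on `[a,b] ⊆ [0,τ]`, then
`x₂(t) ≥ x₂(a) − (32U² + 16κ₁G)(t − a)` on `[a,b]`. [this file] -/
theorem x2_lower_linear (h : PseudoFlowOn τ 1 α κ₁ κ₂ S₀ F₀ B₀ S F) (hrows : RelayRows α) (hτ : 0 < τ) (hκ : 0 ≤ κ₁)
    {a b U G : ℝ} (ha : 0 ≤ a) (hab : a ≤ b) (hb : b ≤ τ)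
    (hU : ∀ s ∈ Icc a b, |S 1 2 s| ≤ U) (hG : ∀ s ∈ Icc a b, Real.sqrt (F 0 2 s) ≤ G) :
    ∀ t ∈ Icc a b, S 0 2 a - (32 * U ^ 2 + 16 * κ₁ * G) * (t - a) ≤ S 0 2 t := by
  refine lower_linear_of_derivWithin_ge hτ (h.contDiffOn_S 0 2) ha hab hb fun s hs => ?_
  have hsτ : s ∈ Icc 0 τ := ⟨ha.trans hs.1, hs.2.trans hb⟩
  have h1 := x2_deriv_lower h hrows hsτ
  have h2 : S 1 2 s ^ 2 ≤ U ^ 2 := by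
    have := hU s hs
    rw [← sq_abs]; exact pow_le_pow_left₀ (abs_nonneg _) this 2
  have h3 := hG s hs
  nlinarith [mul_le_mul_of_nonneg_left h3 (by positivity : (0 : ℝ) ≤ 16 * κ₁)]

/-- **The next relay, one-sided row bound**: `r₁′ ≥ (Λ₁/32)(x₂u₁ − u₁u₂) − 4κ₁√F 2 1`. [this file] -/
theorem r1_deriv_lower (h : PseudoFlowOn τ 1 α κ₁ κ₂ S₀ F₀ B₀ S F) (hrows : RelayRows α)
    {s : ℝ} (hs : s ∈ Icc 0 τ) :
    (1 / 32) * ((1 + 1 : ℝ) ^ ((5 : ℝ) * ((1 : ℤ) : ℝ) / 2) * (S 0 2 s * S 1 1 s - S 1 1 s * S 1 2 s))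
      - κ₁ * 4 * Real.sqrt (F 2 1 s) ≤ derivWithin (S 2 1) (Icc 0 τ) s := by
  have hm := h.motion 2 1 s hs
  rw [hrows.2.2.1 S 1 s, weight_at_one] at hm
  have hlow := (abs_le.mp hm).1
  have e : (1 : ℤ) + 1 = 2 := by norm_num
  rw [e] at hlow
  linarith

/-- **Linear lower bound for `r₁` on a sub-interval**: if on `[a,b] ⊆ [0,τ]`: `0 ≤ u₁ ≤ U₁`, `x₂ ≥ −X`, `u₂ ≤ U`
(`X, U ≥ 0`), `√(F 2 1) ≤ G₁`, then `r₁(t) ≥ r₁(a) − ((Λ₁/32)·U₁·(X + U) + 4κ₁G₁)(t − a)`, where `Λ₁ = (1+1)^{5/2}`.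
[this file] -/
theorem r1_lower_linear (h : PseudoFlowOn τ 1 α κ₁ κ₂ S₀ F₀ B₀ S F) (hrows : RelayRows α) (hτ : 0 < τ) (hκ : 0 ≤ κ₁)
    {a b U₁ X U G₁ : ℝ} (ha : 0 ≤ a) (hab : a ≤ b) (hb : b ≤ τ) (hX : 0 ≤ X) (hU : 0 ≤ U)
    (hu1 : ∀ s ∈ Icc a b, 0 ≤ S 1 1 s ∧ S 1 1 s ≤ U₁) (hx2 : ∀ s ∈ Icc a b, -X ≤ S 0 2 s)
    (hu2 : ∀ s ∈ Icc a b, S 1 2 s ≤ U) (hG : ∀ s ∈ Icc a b, Real.sqrt (F 2 1 s) ≤ G₁) :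
    ∀ t ∈ Icc a b, S 2 1 a - ((1 / 32) * (1 + 1 : ℝ) ^ ((5 : ℝ) * ((1 : ℤ) : ℝ) / 2) * U₁ * (X + U) + 4 * κ₁ * G₁) * (t - a)
      ≤ S 2 1 t := by
  refine lower_linear_of_derivWithin_ge hτ (h.contDiffOn_S 2 1) ha hab hb fun s hs => ?_
  have hsτ : s ∈ Icc 0 τ := ⟨ha.trans hs.1, hs.2.trans hb⟩
  have h1 := r1_deriv_lower h hrows hsτ
  set L := (1 + 1 : ℝ) ^ ((5 : ℝ) * ((1 : ℤ) : ℝ) / 2) with hL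
  have hL0 : 0 ≤ L := clock_nonneg _
  obtain ⟨hu0, huU⟩ := hu1 s hs
  have h2 := hx2 s hs; have h3 := hu2 s hs; have h4 := hG s hs
  -- x₂u₁ − u₁u₂ = u₁ (x₂ − u₂) ≥ −U₁ (X + U)
  have h5 : -(U₁ * (X + U)) ≤ S 0 2 s * S 1 1 s - S 1 1 s * S 1 2 s := by
    have e : S 0 2 s * S 1 1 s - S 1 1 s * S 1 2 s = S 1 1 s * (S 0 2 s - S 1 2 s) := by ring
    rw [e]
    have h6 : -(X + U) ≤ S 0 2 s - S 1 2 s := by linarith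
    have h7 : S 1 1 s * (-(X + U)) ≤ S 1 1 s * (S 0 2 s - S 1 2 s) := mul_le_mul_of_nonneg_left h6 hu0
    have h8 : U₁ * (-(X + U)) ≤ S 1 1 s * (-(X + U)) := by
      have : -(X + U) ≤ 0 := by linarith
      exact mul_le_mul_of_nonpos_right huU this
    linarith
  have h9 : (1 / 32) * (L * (-(U₁ * (X + U)))) ≤ (1 / 32) * (L * (S 0 2 s * S 1 1 s - S 1 1 s * S 1 2 s)) :=
    mul_le_mul_of_nonneg_left (mul_le_mul_of_nonneg_left h5 hL0) (by norm_num)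
  nlinarith [mul_le_mul_of_nonneg_left h4 (by positivity : (0 : ℝ) ≤ 4 * κ₁)]

/-- **Old shell 2's relay moves slowly**: if on `[a,b] ⊆ [0,τ]`: `|x₃|, |u₃| ≤ X₃`, `|u₂| ≤ U`, `√(F 2 2) ≤ G₂`, then
`|r₂(t) − r₂(a)| ≤ (2·X₃·U + 16κ₁G₂)(t − a)` (`r₂′ = (Λ₂/32)(x₃u₂ − u₂u₃) ± defect`, `Λ₂/32 = 1`). [this file] -/
theorem r2_abs_linear (h : PseudoFlowOn τ 1 α κ₁ κ₂ S₀ F₀ B₀ S F) (hrows : RelayRows α) (hτ : 0 < τ) (hκ : 0 ≤ κ₁)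
    {a b X₃ U G₂ : ℝ} (ha : 0 ≤ a) (hab : a ≤ b) (hb : b ≤ τ)
    (hx3 : ∀ s ∈ Icc a b, |S 0 3 s| ≤ X₃) (hu3 : ∀ s ∈ Icc a b, |S 1 3 s| ≤ X₃) (hu2 : ∀ s ∈ Icc a b, |S 1 2 s| ≤ U)
    (hG : ∀ s ∈ Icc a b, Real.sqrt (F 2 2 s) ≤ G₂) :
    ∀ t ∈ Icc a b, |S 2 2 t - S 2 2 a| ≤ (2 * X₃ * U + 16 * κ₁ * G₂) * (t - a) := by
  refine abs_sub_le_linear_of_abs_derivWithin_le hτ (h.contDiffOn_S 2 2) ha hab hb fun s hs => ?_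
  have hsτ : s ∈ Icc 0 τ := ⟨ha.trans hs.1, hs.2.trans hb⟩
  have hm := h.motion 2 2 s hsτ
  rw [hrows.2.2.1 S 2 s, clock_at_two, weight_at_two] at hm
  have e : (2 : ℤ) + 1 = 3 := by norm_num
  rw [e] at hm
  -- |q| ≤ (1/32)·32·(|x₃||u₂| + |u₂||u₃|) ≤ 2 X₃ U
  have hX₃ : 0 ≤ X₃ := (abs_nonneg _).trans (hx3 s hs)
  have hU0 : 0 ≤ U := (abs_nonneg _).trans (hu2 s hs)
  have hq : |(1 / 32 : ℝ) * (32 * (S 0 3 s * S 1 2 s - S 1 2 s * S 1 3 s))| ≤ 2 * X₃ * U := by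
    rw [show (1 / 32 : ℝ) * (32 * (S 0 3 s * S 1 2 s - S 1 2 s * S 1 3 s)) = S 0 3 s * S 1 2 s - S 1 2 s * S 1 3 s by ring]
    have h1 : |S 0 3 s * S 1 2 s| ≤ X₃ * U := by rw [abs_mul]; exact mul_le_mul (hx3 s hs) (hu2 s hs) (abs_nonneg _) hX₃
    have h2 : |S 1 2 s * S 1 3 s| ≤ U * X₃ := by rw [abs_mul]; exact mul_le_mul (hu2 s hs) (hu3 s hs) (abs_nonneg _) hU0
    calc |S 0 3 s * S 1 2 s - S 1 2 s * S 1 3 s| ≤ |S 0 3 s * S 1 2 s| + |S 1 2 s * S 1 3 s| := abs_sub _ _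
      _ ≤ X₃ * U + U * X₃ := add_le_add h1 h2
      _ = 2 * X₃ * U := by ring
  have hd : |derivWithin (S 2 2) (Icc 0 τ) s - (1 / 32 : ℝ) * (32 * (S 0 3 s * S 1 2 s - S 1 2 s * S 1 3 s))| ≤
      κ₁ * 16 * Real.sqrt (F 2 2 s) := hm
  have hG' := hG s hs
  calc |derivWithin (S 2 2) (Icc 0 τ) s|
      ≤ |derivWithin (S 2 2) (Icc 0 τ) s - (1 / 32 : ℝ) * (32 * (S 0 3 s * S 1 2 s - S 1 2 s * S 1 3 s))| +
          |(1 / 32 : ℝ) * (32 * (S 0 3 s * S 1 2 s - S 1 2 s * S 1 3 s))| := by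
        have := abs_add_le (derivWithin (S 2 2) (Icc 0 τ) s - (1 / 32 : ℝ) * (32 * (S 0 3 s * S 1 2 s - S 1 2 s * S 1 3 s)))
          ((1 / 32 : ℝ) * (32 * (S 0 3 s * S 1 2 s - S 1 2 s * S 1 3 s)))
        simpa using this
    _ ≤ κ₁ * 16 * G₂ + 2 * X₃ * U := add_le_add (hd.trans (mul_le_mul_of_nonneg_left hG' (by positivity))) hq
    _ = (2 * X₃ * U + 16 * κ₁ * G₂) := by ring

/-- **The front relay is non-decreasing** where its row is nonnegative up to the defect: if on `[a,b] ⊆ [0,τ]`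
`(1/32)·u₀·(x₁ − u₁) ≥ κ₁√(F 2 0)` (e.g. `u₀ > 0`, `x₁ − u₁ ≥ …`), then `r₀(a) ≤ r₀(t)` on `[a,b]`
(`r₀′ = (Λ₀/32)(x₁u₀ − u₀u₁) ± κ₁·1·√F`, `Λ₀ = 1`). [this file] -/
theorem r0_monotone_of (h : PseudoFlowOn τ 1 α κ₁ κ₂ S₀ F₀ B₀ S F) (hrows : RelayRows α) (hτ : 0 < τ)
    {a b : ℝ} (ha : 0 ≤ a) (hab : a ≤ b) (hb : b ≤ τ)
    (hpos : ∀ s ∈ Icc a b, κ₁ * Real.sqrt (F 2 0 s) ≤ (1 / 32) * (S 1 0 s * (S 0 1 s - S 1 1 s))) :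
    ∀ t ∈ Icc a b, S 2 0 a ≤ S 2 0 t := by
  intro t ht
  have h0 := lower_linear_of_derivWithin_ge (C := 0) hτ (h.contDiffOn_S 2 0) ha hab hb (fun s hs => ?_) t ht
  · simpa using h0
  have hsτ : s ∈ Icc 0 τ := ⟨ha.trans hs.1, hs.2.trans hb⟩
  have hm := h.motion 2 0 s hsτ
  rw [hrows.2.2.1 S 0 s] at hm
  have e0 : (1 + 1 : ℝ) ^ ((5 : ℝ) * ((0 : ℤ) : ℝ) / 2) = 1 := by norm_num
  have e1 : (1 + 1 : ℝ) ^ ((2 : ℝ) * ((0 : ℤ) : ℝ)) = 1 := by norm_num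
  have e2 : (0 : ℤ) + 1 = 1 := by norm_num
  rw [e0, e1, e2] at hm
  have hlow := (abs_le.mp hm).1
  have hp := hpos s hs
  have e3 : (1 / 32 : ℝ) * (1 * (S 0 1 s * S 1 0 s - S 1 0 s * S 1 1 s)) = (1 / 32) * (S 1 0 s * (S 0 1 s - S 1 1 s)) := by ring
  rw [e3] at hlow
  linarith

end Summit.NavierStokesRegularity.NavierStokesRegularity.Cruxes.RelayFrontStep.Window2
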